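import Literature.Analysis.SpecialFunctions.ClausenFormula
import Literature.NumberTheory.Automorphic.ZhouLegendreGreenValuesProofs
import Mathlib.RingTheory.PowerSeries.Derivative
import Mathlib.RingTheory.Derivation.Basic
import Mathlib.Analysis.Normed.Ring.InfiniteSum
import HarnessLib

/-!
# Proofs: the iterated Euler integral for `₃F₂` (Andrews–Askey–Roy (2.2.2) with `p = 2`, `q = 1`)

Topic `Literature/Analysis/SpecialFunctions`; companion ("`…Proofs`") file of `ClausenFormula.lean`,
which vendors `EulerIntegralThreeFTwo` as a named fact. Here we DISCHARGE it:
`EulerIntegralThreeFTwo_holds`.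

## The printed proof and the road taken

G. E. Andrews, R. Askey, R. Roy, *Special Functions* (CUP 1999), §2.2: Theorem 2.2.1 (Euler's
integral for `₂F₁`) is proved for `|x| < 1` by expanding `(1 − xt)^{−a}` binomially, integrating
termwise against the beta density `t^{b−1}(1−t)^{c−b−1}`, and evaluating each Beta integral
`∫₀¹ t^{n+b−1}(1−t)^{c−b−1} dt = Γ(n+b)Γ(c−b)/Γ(n+c)`; the text then observes ("More generally, we
have (2.2.2)") that the same computation, with the `₁F₀` replaced by any `ₚF_q`, adds one numerator
parameter `a_{p+1}` and one denominator parameter `b_{q+1}`: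
`ₚ₊₁F_{q+1}(…, a_{p+1}; …, b_{q+1}; x)
  = Γ(b_{q+1})/(Γ(a_{p+1})Γ(b_{q+1} − a_{p+1})) ∫₀¹ t^{a_{p+1}−1}(1−t)^{b_{q+1}−a_{p+1}−1} ₚF_q(…; xt) dt`
"when `Re b_{q+1} > Re a_{p+1} > 0`". We formalize exactly this for `p = 2`, `q = 1`, real parameters
and real `|x| < 1`, following the printed steps and the tree's proof of Theorem 2.2.1
(`Literature.NumberTheory.Automorphic.LegendreP.euler_integral_ordinaryHypergeometric`):

1. `₂F₁(a₁, a₂; b₁; xt) = Σₙ Aₙ (xt)ⁿ` for `t ∈ (0, 1]` (`LegendreP.hasSum_ordinaryHypergeometric`);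
2. sum and integral are exchanged by dominated convergence
   (`intervalIntegral.hasSum_integral_of_dominated_convergence`) with the summable majorant
   `|Aₙ| |x|ⁿ · t^{a₃−1}(1−t)^{b₂−a₃−1}` (`LegendreP.summable_abs_ordinaryHypergeometricCoefficient_mul_pow`);
3. each term is a Beta integral (`Literature.NumberTheory.LFunctions.integral_rpow_mul_one_sub_rpow`),
   and `Γ(a₃ + n) = (a₃)ₙ Γ(a₃)`, `Γ(b₂ + n) = (b₂)ₙ Γ(b₂)` (AAR (1.1.6),
   `LegendreP.Gamma_add_nat_eq_ascPochhammer_mul`) turn `Γ(b₂)/(Γ(a₃)Γ(b₂−a₃)) · Γ(a₃+n)Γ(b₂−a₃)/Γ(b₂+n)`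
   into `(a₃)ₙ/(b₂)ₙ`, so the `n`-th term is `Aₙ (a₃)ₙ/(b₂)ₙ xⁿ = threeFTwoCoeff a₁ a₂ a₃ b₁ b₂ n · xⁿ`.

The fact carries the hypothesis `b₁ ∉ {0, −1, −2, …}` (so that the printed `₂F₁` is defined); with
Mathlib's junk convention `(b₁)ₙ⁻¹ = 0` on both sides the identity holds without it, so the working
theorem `hasSum_threeFTwoCoeff_eulerIntegral` omits it and `EulerIntegralThreeFTwo_holds` discards it.

## Main statements (all proved; no new definitions, no new named facts)

* `threeFTwoCoeff_eq_mul`: `threeFTwoCoeff a₁ a₂ a₃ b₁ b₂ n = Aₙ(a₁,a₂;b₁) · (a₃)ₙ · (b₂)ₙ⁻¹`.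
* `integral_pow_mul_beta_weight`: the Beta moments
  `∫₀¹ tⁿ · t^{p−1}(1−t)^{q−1} dt = (p)ₙ Γ(p)Γ(q)/((p+q)ₙ Γ(p+q))` for `p, q > 0`.
* `eulerIntegral_prefactor_cancel`: the field identity cancelling the Gamma prefactor (step 3).
* `hasSum_threeFTwoCoeff_eulerIntegral`: (2.2.2) for `p = 2`, `q = 1`, real `b₂ > a₃ > 0`, `|x| < 1`.
* `EulerIntegralThreeFTwo_holds : EulerIntegralThreeFTwo` — the discharge.

## References

* G. E. Andrews, R. Askey, R. Roy, *Special Functions*, Encyclopedia Math. Appl. 71, CUP 1999,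
  §2.2, Theorem 2.2.1 and eq. (2.2.2); (1.1.6). [`AndrewsAskeyRoy1999`]
-/

noncomputable section

open Real Set
open _root_.MeasureTheory
open scoped BigOperators

open Literature.NumberTheory.Automorphic.LegendreP (hasSum_ordinaryHypergeometric
  summable_abs_ordinaryHypergeometricCoefficient_mul_pow intervalIntegrable_rpow_mul_one_sub_rpow
  Gamma_add_nat_eq_ascPochhammer_mul)
open Literature.NumberTheory.LFunctions (integral_rpow_mul_one_sub_rpow)

namespace Literature.Analysis.SpecialFunctions

/-- The `₃F₂` coefficient is the `₂F₁` coefficient times `(a₃)ₙ/(b₂)ₙ`: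
`threeFTwoCoeff a₁ a₂ a₃ b₁ b₂ n = Aₙ(a₁, a₂; b₁) · (a₃)ₙ · (b₂)ₙ⁻¹` (Mathlib's
`ordinaryHypergeometricCoefficient`, same junk conventions). [cite: AndrewsAskeyRoy1999, (2.1.2)] -/
theorem threeFTwoCoeff_eq_mul (a₁ a₂ a₃ b₁ b₂ : ℝ) (n : ℕ) :
    threeFTwoCoeff a₁ a₂ a₃ b₁ b₂ n =
      ordinaryHypergeometricCoefficient a₁ a₂ b₁ n * (ascPochhammer ℝ n).eval a₃ *
        ((ascPochhammer ℝ n).eval b₂)⁻¹ := by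
  simp only [threeFTwoCoeff, ordinaryHypergeometricCoefficient]
  ring

/-- **Beta moments**: for `p, q > 0` and `n ∈ ℕ`,
`∫₀¹ tⁿ · t^{p−1}(1−t)^{q−1} dt = Γ(p+n)Γ(q)/Γ(p+q+n) = (p)ₙ Γ(p) Γ(q) / ((p+q)ₙ Γ(p+q))`
(the Beta integral `B(p+n, q)` together with `Γ(b+n) = (b)ₙ Γ(b)`).
[cite: AndrewsAskeyRoy1999, §2.2 (proof of Thm 2.2.1) and (1.1.6)] -/
theorem integral_pow_mul_beta_weight {p q : ℝ} (hp : 0 < p) (hq : 0 < q) (n : ℕ) :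
    ∫ t in (0 : ℝ)..1, t ^ n * (t ^ (p - 1) * (1 - t) ^ (q - 1)) =
      (ascPochhammer ℝ n).eval p * Real.Gamma p * Real.Gamma q /
        ((ascPochhammer ℝ n).eval (p + q) * Real.Gamma (p + q)) := by
  have hpq : 0 < p + q := by positivity
  have h := integral_rpow_mul_one_sub_rpow (a := p + n) (b := q) (by positivity) hq
  rw [show p + (n : ℝ) + q = (p + q) + n by ring, Gamma_add_nat_eq_ascPochhammer_mul hp,
    Gamma_add_nat_eq_ascPochhammer_mul hpq] at h
  rw [← h]
  refine intervalIntegral.integral_congr_ae (ae_of_all _ fun t ht => ?_)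
  rw [Set.uIoc_of_le zero_le_one] at ht
  rw [← mul_assoc, ← Real.rpow_natCast, ← Real.rpow_add ht.1]
  ring_nf

/-- The cancellation of the Gamma prefactor in step 3 of the printed proof:
`Γ(b₂)/(Γ(a₃)Γ(b₂−a₃)) · (A·X·((a₃)ₙΓ(a₃)Γ(b₂−a₃)/((b₂)ₙΓ(b₂)))) = A·(a₃)ₙ·(b₂)ₙ⁻¹·X`, as a field
identity in named atoms. [folklore] -/
theorem eulerIntegral_prefactor_cancel {Γa Γba Γb P Q A X : ℝ} (hΓa : Γa ≠ 0) (hΓba : Γba ≠ 0)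
    (hΓb : Γb ≠ 0) :
    Γb / (Γa * Γba) * (A * X * (P * Γa * Γba / (Q * Γb))) = A * P * Q⁻¹ * X := by
  calc Γb / (Γa * Γba) * (A * X * (P * Γa * Γba / (Q * Γb)))
      = A * P * Q⁻¹ * X * (Γa * Γa⁻¹) * (Γba * Γba⁻¹) * (Γb * Γb⁻¹) := by
        simp only [div_eq_mul_inv, mul_inv]
        ring
    _ = A * P * Q⁻¹ * X := by
        rw [mul_inv_cancel₀ hΓa, mul_inv_cancel₀ hΓba, mul_inv_cancel₀ hΓb, mul_one, mul_one,
          mul_one]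

/-- **The iterated Euler integral for `₃F₂`** (Andrews–Askey–Roy (2.2.2), `p = 2`, `q = 1`), in
hypothesis form: for real `b₂ > a₃ > 0` and real `|x| < 1`,
`Σₙ threeFTwoCoeff a₁ a₂ a₃ b₁ b₂ n · xⁿ
  = Γ(b₂)/(Γ(a₃)Γ(b₂−a₃)) · ∫₀¹ t^{a₃−1}(1−t)^{b₂−a₃−1} ₂F₁(a₁, a₂; b₁; xt) dt`
as a `HasSum`. No hypothesis on `b₁`: at a pole `b₁ ∈ −ℕ` both sides use Mathlib's junk coefficient
`(b₁)ₙ⁻¹ = 0`, and the identity still holds term by term. Proof: termwise Beta integration, exactly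
as in the printed proof of Theorem 2.2.1. [cite: AndrewsAskeyRoy1999, §2.2 eq. (2.2.2)] -/
theorem hasSum_threeFTwoCoeff_eulerIntegral {a₁ a₂ a₃ b₁ b₂ x : ℝ} (ha : 0 < a₃) (hab : a₃ < b₂)
    (hx : |x| < 1) :
    HasSum (fun n : ℕ => threeFTwoCoeff a₁ a₂ a₃ b₁ b₂ n * x ^ n)
      (Real.Gamma b₂ / (Real.Gamma a₃ * Real.Gamma (b₂ - a₃)) *
        ∫ t in (0 : ℝ)..1, t ^ (a₃ - 1) * (1 - t) ^ (b₂ - a₃ - 1) *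
          ordinaryHypergeometric (𝕂 := ℝ) a₁ a₂ b₁ (x * t)) := by
  have hba : 0 < b₂ - a₃ := sub_pos.mpr hab
  have hb : 0 < b₂ := ha.trans hab
  set C : ℝ := Real.Gamma b₂ / (Real.Gamma a₃ * Real.Gamma (b₂ - a₃)) with hC
  set A : ℕ → ℝ := fun n => ordinaryHypergeometricCoefficient a₁ a₂ b₁ n with hA
  set w : ℝ → ℝ := fun t => t ^ (a₃ - 1) * (1 - t) ^ (b₂ - a₃ - 1) with hw
  set F : ℕ → ℝ → ℝ := fun n t => A n * x ^ n * (t ^ n * w t) with hF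
  set bound : ℕ → ℝ → ℝ := fun n t => |A n| * |x| ^ n * w t with hbound
  have hw_int : IntervalIntegrable w volume 0 1 := by
    have := intervalIntegrable_rpow_mul_one_sub_rpow ha hba
    simpa only [hw] using this
  have hw_nonneg : ∀ t ∈ Set.Ioc (0 : ℝ) 1, 0 ≤ w t := fun t ht =>
    mul_nonneg (Real.rpow_nonneg ht.1.le _) (Real.rpow_nonneg (by linarith [ht.2]) _)
  -- `Σ |Aₙ| |x|ⁿ < ∞`: absolute convergence of the `₂F₁` series inside the unit disc
  have hAx : Summable fun n : ℕ => |A n| * |x| ^ n :=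
    summable_abs_ordinaryHypergeometricCoefficient_mul_pow a₁ a₂ b₁ |x| (abs_nonneg x) hx
  have hF_meas : ∀ n, AEStronglyMeasurable (F n) (volume.restrict (Set.uIoc (0 : ℝ) 1)) := by
    intro n
    apply Measurable.aestronglyMeasurable
    simp only [hF, hw]
    fun_prop
  have h_bound : ∀ n, ∀ᵐ t ∂volume, t ∈ Set.uIoc (0 : ℝ) 1 → ‖F n t‖ ≤ bound n t := by
    intro n
    refine ae_of_all _ fun t ht => ?_
    rw [Set.uIoc_of_le zero_le_one] at ht
    have hwt := hw_nonneg t ht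
    have htn : t ^ n ≤ 1 := pow_le_one₀ ht.1.le ht.2
    have htn0 : 0 ≤ t ^ n := pow_nonneg ht.1.le n
    simp only [hF, hbound, Real.norm_eq_abs, abs_mul, abs_pow, abs_of_nonneg hwt,
      abs_of_nonneg htn0]
    calc |A n| * |x| ^ n * (t ^ n * w t) ≤ |A n| * |x| ^ n * (1 * w t) := by gcongr
      _ = |A n| * |x| ^ n * w t := by rw [one_mul]
  have bound_summable : ∀ᵐ t ∂volume, t ∈ Set.uIoc (0 : ℝ) 1 → Summable fun n => bound n t :=
    ae_of_all _ fun t _ => by simpa only [hbound] using hAx.mul_right (w t)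
  have bound_integrable : IntervalIntegrable (fun t => ∑' n, bound n t) volume 0 1 := by
    have e : (fun t => ∑' n, bound n t) = fun t => (∑' n : ℕ, |A n| * |x| ^ n) * w t := by
      funext t; simp only [hbound]; exact tsum_mul_right
    rw [e]
    exact hw_int.const_mul _
  -- step 1: the `₂F₁` series at `xt`, multiplied by the weight
  have h_lim : ∀ᵐ t ∂volume, t ∈ Set.uIoc (0 : ℝ) 1 →
      HasSum (fun n => F n t) (w t * ordinaryHypergeometric a₁ a₂ b₁ (x * t)) := by
    refine ae_of_all _ fun t ht => ?_
    rw [Set.uIoc_of_le zero_le_one] at ht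
    have hxt : |x * t| < 1 := by
      rw [abs_mul, abs_of_pos ht.1]
      calc |x| * t ≤ |x| * 1 := by gcongr; exact ht.2
        _ < 1 := by rw [mul_one]; exact hx
    have h := (hasSum_ordinaryHypergeometric a₁ a₂ b₁ hxt).mul_left (w t)
    have e : (fun n => F n t) = fun n : ℕ =>
        w t * (ordinaryHypergeometricCoefficient a₁ a₂ b₁ n * (x * t) ^ n) := by
      funext n; simp only [hF, hA, mul_pow]; ring
    rw [e]; exact h
  -- step 2: termwise integration (dominated convergence)
  have hmain := intervalIntegral.hasSum_integral_of_dominated_convergence bound hF_meas h_bound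
    bound_summable bound_integrable h_lim
  -- step 3: each term is a Beta integral; the Gamma prefactor leaves `(a₃)ₙ/(b₂)ₙ`
  have hFn : ∀ n : ℕ, C * ∫ t in (0 : ℝ)..1, F n t = threeFTwoCoeff a₁ a₂ a₃ b₁ b₂ n * x ^ n := by
    intro n
    have hI : ∫ t in (0 : ℝ)..1, t ^ n * w t =
        (ascPochhammer ℝ n).eval a₃ * Real.Gamma a₃ * Real.Gamma (b₂ - a₃) /
          ((ascPochhammer ℝ n).eval b₂ * Real.Gamma b₂) := by
      have h := integral_pow_mul_beta_weight ha hba n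
      rw [show a₃ + (b₂ - a₃) = b₂ by ring] at h
      simpa only [hw] using h
    have hInt : ∫ t in (0 : ℝ)..1, F n t = A n * x ^ n * ∫ t in (0 : ℝ)..1, t ^ n * w t := by
      simp only [hF]; exact intervalIntegral.integral_const_mul _ _
    have hbn : (ascPochhammer ℝ n).eval b₂ ≠ 0 := (ascPochhammer_pos n b₂ hb).ne'
    have hΓa : Real.Gamma a₃ ≠ 0 := (Real.Gamma_pos_of_pos ha).ne'
    have hΓb : Real.Gamma b₂ ≠ 0 := (Real.Gamma_pos_of_pos hb).ne'
    have hΓba : Real.Gamma (b₂ - a₃) ≠ 0 := (Real.Gamma_pos_of_pos hba).ne'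
    rw [hInt, hI, threeFTwoCoeff_eq_mul]
    simp only [hC, hA]
    exact eulerIntegral_prefactor_cancel hΓa hΓba hΓb
  have e : (fun n => C * ∫ t in (0 : ℝ)..1, F n t) =
      fun n : ℕ => threeFTwoCoeff a₁ a₂ a₃ b₁ b₂ n * x ^ n := funext hFn
  have h2 := hmain.mul_left C
  rw [e] at h2
  simpa only [hw] using h2

/-- **Discharge of `EulerIntegralThreeFTwo`** (Andrews–Askey–Roy (2.2.2) with `p = 2`, `q = 1`, real
parameters `b₂ > a₃ > 0`, `b₁ ∉ −ℕ`, real `|x| < 1`): from `hasSum_threeFTwoCoeff_eulerIntegral`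
(the hypothesis on `b₁` is not needed for the identity and is discarded).
[cite: AndrewsAskeyRoy1999, §2.2 eq. (2.2.2)] -/
theorem EulerIntegralThreeFTwo_holds : EulerIntegralThreeFTwo :=
  fun _a₁ _a₂ _a₃ _b₁ _b₂ _x ha hab _ hx => hasSum_threeFTwoCoeff_eulerIntegral ha hab hx

end Literature.Analysis.SpecialFunctions

/-!
# Part II. Clausen's formula — proof (discharge of the named fact `ClausenFormula`)

This part lands `theorem ClausenFormula_holds : ClausenFormula`, i.e. T. Clausen's identity (1828)
as printed in Andrews–Askey–Roy, Exercise 2.13 (p. 116) and (7.4.6),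
`[₂F₁(a, b; a+b+½; x)]² = ₃F₂(2a, 2b, a+b; 2a+2b, a+b+½; x)` for real parameters off the poles of
the lower parameters and real `|x| < 1`.

## The printed proof and how it is formalized

Andrews–Askey–Roy, Exercise 2.13: *both* `y₁ = [₂F₁(a,b;a+b+½;x)]²` and
`y₂ = ₃F₂(2a,2b,a+b;2a+2b,a+b+½;x)` satisfy the third-order equation
`x²(x−1)y''' − 3x(a+b+½ − (a+b+1)x)y'' + {[2(a²+b²+4ab)+3(a+b)+1]x − (a+b)(2a+2b+1)}y'
  + 4ab(a+b)y = 0`,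
"thus prove Clausen's identity". We run exactly this argument, but on FORMAL power series, which
turns the analysis of the singular ODE (indicial roots `0, 1−b₁, 1−b₂` at `x = 0`, uniqueness of
the holomorphic solution with `y(0) = 1`) into an elementary coefficient recurrence:

* `θ` is the Euler operator `X·d/dX` on `ℝ⟦X⟧`: the algebraic lemmas are stated for any
  `ℝ`-derivation `θ` of `ℝ⟦X⟧` with `coeff n (θf) = n·coeff n f` (which pins it down), and
  `Clausen.coeff_X_smul_derivative` shows `X • d/dX` is one.
* `Clausen.symmSq_identity` — the **symmetric square** of a second-order operator, as a universal
  identity for any derivation `D` of a commutative ring and any `p q r y`: with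
  `ε := p·D²y + q·Dy − r·y`,
  `p²D³(y²) + 3pq·D²(y²) + (2q² + Dq·p − q·Dp − 4rp)·D(y²) + (2r·Dp − 2p·Dr − 4qr)·y²
     = 6p·Dy·ε + 2p·y·Dε + (4q − 2Dp)·y·ε`
  (pure `ring` after Leibniz) — this is the computation "`y₁` satisfies the equation".
* `Clausen.ode` — the hypergeometric equation (AAR (2.3.5)) in `θ`-form for a formal series
  `Y = Σ Aₙ Xⁿ` whose coefficients obey `(n+1)(n+a+b+½)A_{n+1} = (n+a)(n+b)Aₙ`, doubled to clear
  the `½`: `2(1−X)θ²Y + ((2a+2b−1) − (2a+2b)X)θY − 2abX·Y = 0` (for the `₂F₁` coefficients the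
  recurrence is the tree's `LegendreP.ordinaryHypergeometricCoefficient_succ_rec`).
* `Clausen.L3_sq_eq_zero` — the special feature of `c = a+b+½`: for these `p, q, r` the
  symmetric-square operator FACTORS as `2(1−X)·L₃`, where
  `L₃ = 2·[θ(θ+2a+2b−1)(θ+a+b−½) − X(θ+2a)(θ+2b)(θ+a+b)]` is (twice) the
  `₃F₂(2a,2b,a+b; 2a+2b, a+b+½)` operator, i.e. the book's third-order equation multiplied back by
  `−2x` (a `ring` identity). Cancelling the non-zero-divisor `2(1−X)` in the domain `ℝ⟦X⟧` gives
  `L₃(Y²) = 0` — "`y₁` satisfies the equation of `y₂`".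
* `Clausen.coeff_sq_rec` reads off `coeff (k+1)` of `L₃(Y²) = 0`:
  `(k+1)(k+2a+2b)(2k+2a+2b+1)·W_{k+1} = 2(k+2a)(k+2b)(k+a+b)·W_k` for `W = Y²`, which is the
  `₃F₂` recurrence (`Clausen.threeFTwoCoeff_succ_rec`); since `W₀ = 1` and the hypotheses keep
  `(k+2a+2b)(k+a+b+½) ≠ 0`, induction gives the **terminating Clausen identity**
  `Σ_{i+j=n} AᵢAⱼ = (2a)ₙ(2b)ₙ(a+b)ₙ/((2a+2b)ₙ(a+b+½)ₙ n!)`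
  (`Clausen.sum_antidiagonal_coeff_mul_coeff`; this is the coefficient identity of AAR
  Exercise 3.17(d), there deduced from the `₄F₃` evaluation 3.17(c)) — "thus `y₁ = y₂`".
* `ClausenFormula_holds` — analysis enters only here: for `|x| < 1` the `₂F₁` series converges
  absolutely to `₂F₁(a,b;a+b+½;x)` (`LegendreP.hasSum_ordinaryHypergeometric`,
  `LegendreP.summable_abs_ordinaryHypergeometricCoefficient_mul_pow`, radius `≥ 1` in every case),
  so by Mertens/Cauchy (Mathlib `tsum_mul_tsum_eq_tsum_sum_antidiagonal_of_summable_norm`) its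
  square is `Σₙ (Σ_{i+j=n} AᵢAⱼ) xⁿ`, and the terminating identity finishes.

Deviations from print: none in substance; the book states the equation in `d/dx`-form divided by
`x`, we keep the equivalent `θ`-form (no division in `ℝ⟦X⟧`), and we double every operator once so
that all constants are polynomial in `a, b` with integer coefficients (`C (1/2)` does not simplify
under ring-hom lemmas). No new definitions and no notation: the operators are written out.

References for this part: Andrews–Askey–Roy, Exercise 2.13 (p. 116), (2.1.2), (2.3.5),
Exercise 3.17(c),(d) (p. 180), (7.4.6) [`AndrewsAskeyRoy1999`]; T. Clausen, J. Reine Angew.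
Math. 3 (1828) 89–91 [`Clausen1828`].
-/

namespace Literature.Analysis.SpecialFunctions

open PowerSeries Finset

namespace Clausen

/-! ### The Euler operator `θ = X d/dX` on formal power series -/

/-- `X • d/dX` is an Euler operator: it multiplies the `n`-th coefficient by `n`. [folklore] -/
theorem coeff_X_smul_derivative (f : ℝ⟦X⟧) (n : ℕ) :
    coeff n (((X : ℝ⟦X⟧) • d⁄dX ℝ : Derivation ℝ ℝ⟦X⟧ ℝ⟦X⟧) f) = (n : ℝ) * coeff n f := by
  rw [Derivation.smul_apply, smul_eq_mul]
  cases n with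
  | zero => simp [coeff_zero_X_mul]
  | succ k =>
    rw [coeff_succ_X_mul, coeff_derivative]
    push_cast
    ring

/-- An Euler operator fixes `X`. [folklore] -/
theorem euler_X (θ : Derivation ℝ ℝ⟦X⟧ ℝ⟦X⟧)
    (hθ : ∀ (f : ℝ⟦X⟧) (n : ℕ), coeff n (θ f) = (n : ℝ) * coeff n f) : θ (X : ℝ⟦X⟧) = X := by
  ext n
  rw [hθ, coeff_X]
  split_ifs with h
  · rw [h]; simp
  · rw [mul_zero]

/-- An Euler operator kills constants. [folklore] -/
theorem euler_C (θ : Derivation ℝ ℝ⟦X⟧ ℝ⟦X⟧)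
    (hθ : ∀ (f : ℝ⟦X⟧) (n : ℕ), coeff n (θ f) = (n : ℝ) * coeff n f) (r : ℝ) : θ (C r) = 0 := by
  ext n
  rw [hθ, coeff_C, map_zero]
  split_ifs with h
  · rw [h]; simp
  · rw [mul_zero]

/-! ### The symmetric square of a second-order operator (the computation behind AAR Ex. 2.13) -/

/-- **Symmetric square identity.** For any derivation `D` of a commutative algebra and any
`p q r y`, writing `ε = p·D²y + q·Dy − r·y` for the second-order operator applied to `y`, the
third-order "symmetric square" operator applied to `y²` is an explicit combination of `ε` and `Dε`:
`p²D³(y²) + 3pq D²(y²) + (2q² + Dq·p − q·Dp − 4rp) D(y²) + (2r·Dp − 2p·Dr − 4qr) y²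
  = 6p·Dy·ε + 2p·y·Dε + (4q − 2Dp)·y·ε`.
In particular `ε = 0` forces the left side to vanish: this is the classical fact that the square
of a solution of `p y'' + q y' − r y = 0` solves a third-order linear equation (the step "`y₁`
satisfies the differential equation" of the exercise).
[cite: AndrewsAskeyRoy1999, Ex. 2.13 (p. 116)] -/
theorem symmSq_identity {R A : Type*} [CommSemiring R] [CommRing A] [Algebra R A]
    (D : Derivation R A A) (p q r y : A) :
    p ^ 2 * D (D (D (y ^ 2))) + 3 * p * q * D (D (y ^ 2))
      + (2 * q ^ 2 + D q * p - q * D p - 4 * r * p) * D (y ^ 2)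
      + (2 * r * D p - 2 * p * D r - 4 * q * r) * y ^ 2
    = 6 * p * D y * (p * D (D y) + q * D y - r * y)
      + 2 * p * y * D (p * D (D y) + q * D y - r * y)
      + (4 * q - 2 * D p) * y * (p * D (D y) + q * D y - r * y) := by
  simp only [pow_two, Derivation.leibniz, map_add, map_sub, smul_eq_mul]
  ring

/-! ### A formal solution `Y` of the `₂F₁(a, b; a+b+½)` equation and its square -/

section Formal

variable (θ : Derivation ℝ ℝ⟦X⟧ ℝ⟦X⟧) {a b : ℝ} {Y : ℝ⟦X⟧}

/-- The (doubled) hypergeometric equation in `θ`-form, coefficient-friendly: if the coefficients of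
`Y` obey the `₂F₁(a,b;a+b+½)` recurrence `(k+1)(k+a+b+½)Y_{k+1} = (k+a)(k+b)Y_k`, then
`2θ²Y + (2a+2b−1)θY = X·(2θ²Y + (2a+2b)θY + 2ab·Y)`. [cite: AndrewsAskeyRoy1999, (2.3.5)] -/
theorem ode' (hθ : ∀ (f : ℝ⟦X⟧) (n : ℕ), coeff n (θ f) = (n : ℝ) * coeff n f)
    (hrec : ∀ k : ℕ, ((k : ℝ) + 1) * ((k : ℝ) + (a + b + 1 / 2)) * coeff (k + 1) Y
      = ((k : ℝ) + a) * ((k : ℝ) + b) * coeff k Y) :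
    C 2 * θ (θ Y) + C (2 * a + 2 * b - 1) * θ Y
      = X * (C 2 * θ (θ Y) + C (2 * a + 2 * b) * θ Y + C (2 * a * b) * Y) := by
  set u : ℝ := 2 * a + 2 * b - 1 with hu
  set v : ℝ := 2 * a + 2 * b with hv
  set w : ℝ := 2 * a * b with hw
  ext n
  cases n with
  | zero =>
    simp only [map_add, coeff_C_mul, hθ, coeff_zero_X_mul, Nat.cast_zero, zero_mul,
      mul_zero, add_zero]
  | succ k =>
    simp only [map_add, coeff_C_mul, hθ, coeff_succ_X_mul]
    rw [hu, hv, hw]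
    push_cast
    linear_combination (2 : ℝ) * hrec k

/-- The hypergeometric equation in operator form `p·θ²Y + q·θY − r·Y = 0` with
`p = 2(1−X)`, `q = (2a+2b−1) − (2a+2b)X`, `r = 2abX`. [cite: AndrewsAskeyRoy1999, (2.3.5)] -/
theorem ode (hθ : ∀ (f : ℝ⟦X⟧) (n : ℕ), coeff n (θ f) = (n : ℝ) * coeff n f)
    (hrec : ∀ k : ℕ, ((k : ℝ) + 1) * ((k : ℝ) + (a + b + 1 / 2)) * coeff (k + 1) Y
      = ((k : ℝ) + a) * ((k : ℝ) + b) * coeff k Y) :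
    C 2 * (1 - X) * θ (θ Y) + (C (2 * a + 2 * b - 1) - C (2 * a + 2 * b) * X) * θ Y
      - C (2 * a * b) * X * Y = 0 := by
  linear_combination ode' θ hθ hrec

/-- **`Y²` solves the `₃F₂(2a,2b,a+b; 2a+2b, a+b+½)` equation** `L₃(Y²) = 0` in `ℝ⟦X⟧`, where
`L₃W = 2θ³W + 3(2a+2b−1)θ²W + (2a+2b−1)²θW − X·(2θ³W + 3(2a+2b)θ²W + (8ab+(2a+2b)²)θW + 8ab(a+b)W)`
`= 2θ(θ+2a+2b−1)(θ+a+b−½)W − X(θ+2a)(θ+2b)(2θ+2a+2b)W` (the exercise's third-order equation times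
`−2x`). Proof: the symmetric-square identity with `ε = 0`, the factorization of the
symmetric-square operator as `2(1−X)·L₃` (special to `c = a+b+½`; a `ring` identity), and
cancellation of the non-zero-divisor `2(1−X)`. [cite: AndrewsAskeyRoy1999, Ex. 2.13 (p. 116)] -/
theorem L3_sq_eq_zero (hθ : ∀ (f : ℝ⟦X⟧) (n : ℕ), coeff n (θ f) = (n : ℝ) * coeff n f)
    (hrec : ∀ k : ℕ, ((k : ℝ) + 1) * ((k : ℝ) + (a + b + 1 / 2)) * coeff (k + 1) Y
      = ((k : ℝ) + a) * ((k : ℝ) + b) * coeff k Y) :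
    C 2 * θ (θ (θ (Y ^ 2))) + C (3 * (2 * a + 2 * b - 1)) * θ (θ (Y ^ 2))
        + C ((2 * a + 2 * b - 1) ^ 2) * θ (Y ^ 2)
      - X * (C 2 * θ (θ (θ (Y ^ 2))) + C (3 * (2 * a + 2 * b)) * θ (θ (Y ^ 2))
        + C (8 * a * b + (2 * a + 2 * b) ^ 2) * θ (Y ^ 2) + C (8 * a * b * (a + b)) * Y ^ 2)
      = 0 := by
  -- the symmetric square of the `₂F₁` operator applied to `Y²` vanishes
  have huniv := symmSq_identity θ (C 2 * (1 - X)) (C (2 * a + 2 * b - 1) - C (2 * a + 2 * b) * X)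
    (C (2 * a * b) * X) Y
  rw [ode θ hθ hrec] at huniv
  simp only [mul_zero, map_zero, add_zero] at huniv
  -- derivatives of the coefficients
  have hX := euler_X θ hθ
  have hC := euler_C θ hθ
  have hp : θ (C 2 * (1 - X)) = -(C 2 * X) := by
    rw [Derivation.leibniz, map_sub, hC, hX, Derivation.map_one_eq_zero]; simp
  have hq : θ (C (2 * a + 2 * b - 1) - C (2 * a + 2 * b) * X) = -(C (2 * a + 2 * b) * X) := by
    rw [map_sub, Derivation.leibniz, hC, hC, hX]; simp
  have hr : θ (C (2 * a * b) * X) = C (2 * a * b) * X := by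
    rw [Derivation.leibniz, hC, hX]; simp
  rw [hp, hq, hr] at huniv
  -- cancel the factor `2(1 - X)`
  have hne : (C (2 : ℝ) * (1 - X) : ℝ⟦X⟧) ≠ 0 := by
    intro h
    have := congrArg (constantCoeff (R := ℝ)) h
    simp at this
  refine (mul_eq_zero.mp ?_).resolve_left hne
  rw [← huniv]
  simp only [map_add, map_sub, map_mul, map_pow, map_ofNat, map_one]
  ring

/-- **The `₃F₂` recurrence for the coefficients of `Y²`**: reading off `coeff (k+1)` of
`L₃(Y²) = 0`, `(k+1)(k+2a+2b)(2k+2a+2b+1)·W_{k+1} = 2(k+2a)(k+2b)(k+a+b)·W_k` for `W = Y²`.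
[cite: AndrewsAskeyRoy1999, Ex. 2.13 (p. 116)] -/
theorem coeff_sq_rec (hθ : ∀ (f : ℝ⟦X⟧) (n : ℕ), coeff n (θ f) = (n : ℝ) * coeff n f)
    (hrec : ∀ k : ℕ, ((k : ℝ) + 1) * ((k : ℝ) + (a + b + 1 / 2)) * coeff (k + 1) Y
      = ((k : ℝ) + a) * ((k : ℝ) + b) * coeff k Y) (k : ℕ) :
    ((k : ℝ) + 1) * ((k : ℝ) + (2 * a + 2 * b)) * (2 * (k : ℝ) + 2 * a + 2 * b + 1)
        * coeff (k + 1) (Y ^ 2)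
      = 2 * ((k : ℝ) + 2 * a) * ((k : ℝ) + 2 * b) * ((k : ℝ) + (a + b)) * coeff k (Y ^ 2) := by
  have hk := congrArg (coeff (k + 1)) (L3_sq_eq_zero θ hθ hrec)
  set u : ℝ := 3 * (2 * a + 2 * b - 1) with hu
  set v : ℝ := (2 * a + 2 * b - 1) ^ 2 with hv
  set u' : ℝ := 3 * (2 * a + 2 * b) with hu'
  set v' : ℝ := 8 * a * b + (2 * a + 2 * b) ^ 2 with hv'
  set w' : ℝ := 8 * a * b * (a + b) with hw'
  simp only [map_add, map_sub, map_zero, coeff_C_mul, hθ, coeff_succ_X_mul] at hk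
  rw [hu, hv, hu', hv', hw'] at hk
  push_cast at hk
  linear_combination hk

end Formal

/-- The `₃F₂` coefficient recurrence `(n+1)(n+b₁)(n+b₂)·c_{n+1} = (n+a₁)(n+a₂)(n+a₃)·cₙ` for
`cₙ = (a₁)ₙ(a₂)ₙ(a₃)ₙ/((b₁)ₙ(b₂)ₙ n!)` (`threeFTwoCoeff`), valid as long as `b₁+n, b₂+n ≠ 0`.
[cite: AndrewsAskeyRoy1999, (2.1.2)] -/
theorem threeFTwoCoeff_succ_rec (a₁ a₂ a₃ b₁ b₂ : ℝ) (n : ℕ)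
    (hb₁ : (n : ℝ) + b₁ ≠ 0) (hb₂ : (n : ℝ) + b₂ ≠ 0) :
    ((n : ℝ) + 1) * ((n : ℝ) + b₁) * ((n : ℝ) + b₂) * threeFTwoCoeff a₁ a₂ a₃ b₁ b₂ (n + 1)
      = ((n : ℝ) + a₁) * ((n : ℝ) + a₂) * ((n : ℝ) + a₃) * threeFTwoCoeff a₁ a₂ a₃ b₁ b₂ n := by
  simp only [threeFTwoCoeff, ascPochhammer_succ_eval, Nat.factorial_succ, Nat.cast_mul,
    Nat.cast_add, Nat.cast_one, mul_inv]
  have hn : ((n : ℝ) + 1) * ((n : ℝ) + 1)⁻¹ = 1 := mul_inv_cancel₀ (by positivity)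
  have h₁ : ((n : ℝ) + b₁) * (b₁ + (n : ℝ))⁻¹ = 1 := by
    rw [add_comm b₁]; exact mul_inv_cancel₀ hb₁
  have h₂ : ((n : ℝ) + b₂) * (b₂ + (n : ℝ))⁻¹ = 1 := by
    rw [add_comm b₂]; exact mul_inv_cancel₀ hb₂
  calc ((n : ℝ) + 1) * ((n : ℝ) + b₁) * ((n : ℝ) + b₂) *
        (((n : ℝ) + 1)⁻¹ * ((n.factorial : ℝ))⁻¹ *
          (Polynomial.eval a₁ (ascPochhammer ℝ n) * (a₁ + n)) *
          (Polynomial.eval a₂ (ascPochhammer ℝ n) * (a₂ + n)) *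
          (Polynomial.eval a₃ (ascPochhammer ℝ n) * (a₃ + n)) *
          ((Polynomial.eval b₁ (ascPochhammer ℝ n))⁻¹ * (b₁ + (n : ℝ))⁻¹) *
          ((Polynomial.eval b₂ (ascPochhammer ℝ n))⁻¹ * (b₂ + (n : ℝ))⁻¹))
      = (((n : ℝ) + 1) * ((n : ℝ) + 1)⁻¹) * (((n : ℝ) + b₁) * (b₁ + (n : ℝ))⁻¹) *
          (((n : ℝ) + b₂) * (b₂ + (n : ℝ))⁻¹) *
        (((n : ℝ) + a₁) * ((n : ℝ) + a₂) * ((n : ℝ) + a₃) *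
          (((n.factorial : ℝ))⁻¹ * Polynomial.eval a₁ (ascPochhammer ℝ n) *
            Polynomial.eval a₂ (ascPochhammer ℝ n) * Polynomial.eval a₃ (ascPochhammer ℝ n) *
            (Polynomial.eval b₁ (ascPochhammer ℝ n))⁻¹ *
            (Polynomial.eval b₂ (ascPochhammer ℝ n))⁻¹)) := by ring
    _ = _ := by rw [hn, h₁, h₂, one_mul, one_mul, one_mul]

/-- **The coefficients of `Y²` are the `₃F₂(2a,2b,a+b; 2a+2b, a+b+½)` coefficients** when the
coefficients of `Y` obey the `₂F₁(a,b;a+b+½)` recurrence, `Y₀ = 1`, and the lower parameters are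
off their poles (same first-order recurrence with non-vanishing leading factor
`(k+1)(k+2a+2b)(2k+2a+2b+1)`, same start `1`). [cite: AndrewsAskeyRoy1999, Ex. 2.13 (p. 116)] -/
theorem coeff_sq_eq_threeFTwoCoeff {a b : ℝ} {Y : ℝ⟦X⟧}
    (hrec : ∀ k : ℕ, ((k : ℝ) + 1) * ((k : ℝ) + (a + b + 1 / 2)) * coeff (k + 1) Y
      = ((k : ℝ) + a) * ((k : ℝ) + b) * coeff k Y)
    (h0 : coeff 0 Y = 1) (h1 : ∀ n : ℕ, a + b + 1 / 2 ≠ -(n : ℝ))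
    (h2 : ∀ n : ℕ, 2 * a + 2 * b ≠ -(n : ℝ)) (n : ℕ) :
    coeff n (Y ^ 2) = threeFTwoCoeff (2 * a) (2 * b) (a + b) (2 * a + 2 * b) (a + b + 1 / 2) n := by
  induction n with
  | zero =>
    rw [threeFTwoCoeff_zero, pow_two, coeff_mul]
    simp [h0]
  | succ k ih =>
    have hb₁ : (k : ℝ) + (2 * a + 2 * b) ≠ 0 := by intro h; exact h2 k (by linarith)
    have hb₂ : (k : ℝ) + (a + b + 1 / 2) ≠ 0 := by intro h; exact h1 k (by linarith)
    have hW := coeff_sq_rec ((X : ℝ⟦X⟧) • d⁄dX ℝ) coeff_X_smul_derivative hrec k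
    have hC := threeFTwoCoeff_succ_rec (2 * a) (2 * b) (a + b) (2 * a + 2 * b) (a + b + 1 / 2)
      k hb₁ hb₂
    have hne : ((k : ℝ) + 1) * ((k : ℝ) + (2 * a + 2 * b)) * (2 * (k : ℝ) + 2 * a + 2 * b + 1)
        ≠ 0 := by
      have hk : (k : ℝ) + 1 ≠ 0 := by positivity
      have h3 : (2 * (k : ℝ) + 2 * a + 2 * b + 1) ≠ 0 := by
        intro h; apply hb₂; linarith
      exact mul_ne_zero (mul_ne_zero hk hb₁) h3
    apply mul_left_cancel₀ hne
    rw [hW, ih]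
    linear_combination (-2 : ℝ) * hC

/-- **Terminating Clausen identity** (the coefficient of `xⁿ` in Clausen's formula): for
`Aₖ = (a)ₖ(b)ₖ/((a+b+½)ₖ k!)` (Mathlib's `ordinaryHypergeometricCoefficient a b (a+b+½)`),
`Σ_{i+j=n} Aᵢ Aⱼ = (2a)ₙ(2b)ₙ(a+b)ₙ / ((2a+2b)ₙ(a+b+½)ₙ n!)`, provided `a+b+½, 2a+2b ∉ −ℕ`.
In print this is Exercise 3.17(d) ("equate the coefficient of `xⁿ` on both sides"), there
obtained from the `₄F₃` summation 3.17(c); here it comes out of Exercise 2.13 applied to the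
formal series `Y = Σ Aₙ Xⁿ`. [cite: AndrewsAskeyRoy1999, Ex. 3.17(d) (p. 180)] -/
theorem sum_antidiagonal_coeff_mul_coeff (a b : ℝ) (h1 : ∀ n : ℕ, a + b + 1 / 2 ≠ -(n : ℝ))
    (h2 : ∀ n : ℕ, 2 * a + 2 * b ≠ -(n : ℝ)) (n : ℕ) :
    ∑ kl ∈ antidiagonal n,
        ordinaryHypergeometricCoefficient a b (a + b + 1 / 2) kl.1 *
          ordinaryHypergeometricCoefficient a b (a + b + 1 / 2) kl.2
      = threeFTwoCoeff (2 * a) (2 * b) (a + b) (2 * a + 2 * b) (a + b + 1 / 2) n := by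
  have hrec : ∀ k : ℕ, ((k : ℝ) + 1) * ((k : ℝ) + (a + b + 1 / 2)) *
      coeff (k + 1) (PowerSeries.mk (ordinaryHypergeometricCoefficient a b (a + b + 1 / 2)))
        = ((k : ℝ) + a) * ((k : ℝ) + b) *
      coeff k (PowerSeries.mk (ordinaryHypergeometricCoefficient a b (a + b + 1 / 2))) := by
    intro k
    have hc : (k : ℝ) + (a + b + 1 / 2) ≠ 0 := by intro h; exact h1 k (by linarith)
    rw [coeff_mk, coeff_mk]
    exact Literature.NumberTheory.Automorphic.LegendreP.ordinaryHypergeometricCoefficient_succ_rec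
      a b (a + b + 1 / 2) k hc
  have h0 : coeff 0 (PowerSeries.mk (ordinaryHypergeometricCoefficient a b (a + b + 1 / 2)))
      = 1 := by
    rw [coeff_mk]; simp [ordinaryHypergeometricCoefficient]
  rw [← coeff_sq_eq_threeFTwoCoeff hrec h0 h1 h2 n, pow_two, coeff_mul]
  simp only [coeff_mk]

end Clausen

/-- **Clausen's formula (1828)** — discharge of the named fact `ClausenFormula`:
`[₂F₁(a, b; a+b+½; x)]² = ₃F₂(2a, 2b, a+b; 2a+2b, a+b+½; x)` for real `a, b`, real `|x| < 1`,
`a+b+½ ∉ −ℕ`, `2a+2b ∉ −ℕ`, as a `HasSum` of the `₃F₂` series to the square. Proof =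
Andrews–Askey–Roy Exercise 2.13 on formal power series (`Clausen.sum_antidiagonal_coeff_mul_coeff`)
+ absolute convergence of the `₂F₁` series on `|x| < 1` and the Cauchy product.
[cite: AndrewsAskeyRoy1999, Ex. 2.13 (p. 116) and (7.4.6)] -/
theorem ClausenFormula_holds : ClausenFormula := by
  intro a b x hx h1 h2
  have hF := hasSum_ordinaryHypergeometric a b (a + b + 1 / 2) hx
  have habs : Summable fun n : ℕ =>
      ‖ordinaryHypergeometricCoefficient a b (a + b + 1 / 2) n * x ^ n‖ := by
    have := summable_abs_ordinaryHypergeometricCoefficient_mul_pow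
      a b (a + b + 1 / 2) |x| (abs_nonneg x) hx
    refine this.congr fun n => ?_
    rw [norm_mul, norm_pow, Real.norm_eq_abs, Real.norm_eq_abs]
  have hprod := tsum_mul_tsum_eq_tsum_sum_antidiagonal_of_summable_norm habs habs
  have hsum : Summable fun n : ℕ => ∑ kl ∈ antidiagonal n,
      ordinaryHypergeometricCoefficient a b (a + b + 1 / 2) kl.1 * x ^ kl.1 *
        (ordinaryHypergeometricCoefficient a b (a + b + 1 / 2) kl.2 * x ^ kl.2) :=
    (summable_norm_sum_mul_antidiagonal_of_summable_norm habs habs).of_norm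
  have hS := hsum.hasSum
  rw [← hprod, hF.tsum_eq, ← pow_two] at hS
  refine hS.congr_fun fun n => ?_
  rw [← Clausen.sum_antidiagonal_coeff_mul_coeff a b h1 h2 n, Finset.sum_mul]
  refine Finset.sum_congr rfl fun kl hkl => ?_
  rw [Finset.HasAntidiagonal.mem_antidiagonal] at hkl
  rw [← hkl, pow_add]
  ring

end Literature.Analysis.SpecialFunctions
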